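import Literature.NumberTheory.Automorphic.ArchEndoscopicCartanAtlasCentralizer   -- ★ (CENT-H): `exists_eq_circleDiagonal_one`, `exists_eq_circleDiagonal_of_mem_unitaryGroupOfForm_diagonal`, GL-level `coe_endoBlock_…`
import Literature.NumberTheory.Rogawski1990.ArchPlaneRegularDichotomy              -- ★ (DICH) p849157: `exists_conj_torusMatrix_or_diagonal_archLocal`, `charpoly_archPiEquivCM_separable_of_isArchGRegular`
import Literature.NumberTheory.Rogawski1990.ArchCompatibleFamiliesScalar           -- ★ (CUR) p849637: `isArchGRegular_conj`
import HarnessLib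

/-!
# Exhaustion: every `G`-regular element of `H_∞` is `H_∞`-conjugate to a regular chart point `endoTorus S c` ((EXH-H); Rogawski 1990 §3.1, §3.6, §4.3; Knapp 1986 V §3)

Topic `NumberTheory/Automorphic`; namespace `Literature.NumberTheory.Automorphic.UnitaryGroup`.  THEOREMS ONLY (no `def`, no instance, no notation, no axiom, no
named fact, no `sorry`).  Cell `pub/hodgecm-mathlib`, crux H413 (`stmt-HodgeConjecture-24833`), F0∕P3c line LH3, DIRECT ROAD of `stub_N9`; seat LH3-p03 (g2); organ
**(EXH-H)** of LH3-plan (g2) (05:43:32Z ∕ 05:49:35Z: «`∀ γH : H_∞, IsArchGRegular L γH → ∃ S c h, c ∈ RegG S ∧ γH = h * endoTorus L S c * h⁻¹` — per place ★ DICH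
dichotomy elliptic∕hyperbolic for the `U(Φ₂)_w` block + log∕arg coordinates; `U(Φ₁)_w` angle»; the first step of O-READ).  Count-neutral.

THE MATHEMATICS.  Let `γ = (γ₂, γ₁) ∈ H_∞ = U(Φ₂)(L⁺ ⊗ ℝ) × U(Φ₁)(L⁺ ⊗ ℝ)` be `G`-regular.  At each complex place `w` the `2`-block `γ₂,w ∈ U(Φ₂)_w = U(1,1)` has separable
characteristic polynomial (★ `charpoly_archPiEquivCM_separable_of_isArchGRegular`), so by the dichotomy ★ `exists_conj_torusMatrix_or_diagonal_archLocal` it is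
`U(Φ₂)_w`-conjugate EITHER to a Cayley block `P·diag(l₁, l₂)·P⁻¹ = torusMatrix l₁ l₂` — and then `|l_i| = 1` (the conjugate lies in `U(P̄ᵀΦ₂P) = U(diag(2, −2))`, ★
`formCongr_cayleyTwo`), `l_i = e^{iθ_i}`, `e^{iθ₀} ≠ e^{iθ₂}` — OR to a diagonal `diag(l₁, l₂)`, `l₁ ≠ l₂` — and then `l̄₁ l₂ = 1` (★ `diag_mem_unitary_antidiag_iff`), i.e.
`diag(e^{x+iθ}, e^{−x+iθ})` with `x = log ‖l₁‖ ≠ 0`, `θ = arg l₁`.  The `U(Φ₁)_w`-entry is `e^{iφ_w}`.  Let `S` be the set of places of the second kind; then with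
`c w = (θ₀, φ_w, θ₂)` resp. `(x, φ_w, θ)` and `h = ((k_w)_w, 1)` (the place conjugators, assembled by ★ `archPiEquivCM`), **`γ = h · endoTorus S c · h⁻¹`**, and `c ∈ RegG S`
because `G`-regularity is a class invariant (★ `isArchGRegular_conj`) and reads `RegG` on the chart (★ `isArchGRegular_endoTorus_iff`).
* §1 place normal forms: `coe_cayleyTwo_mul_diagonal_mul_inv`, `exists_eq_hypBlockGL_of_coe_eq_diag`, `exists_eq_cayley_conj_circleDiagonal_of_coe_eq_torusMatrix`,
  `exists_conj_endoBlock_or`;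
* §2 **`exists_conj_endoTorus_of_isArchGRegular`** (= (EXH-H)), `isArchGRegular_endoTorus_iff_mem_regG` ((COORD) dock).
HONEST LABEL: HC_CM is proved only modulo the 7 printed citations (2 remaining: hLiu418 = `stmt-HodgeConjecture-24832`, h413 = `stmt-HodgeConjecture-24833`) until rung 0
closes; chart bookkeeping, count-neutral (+0∕+0).

## References
* [Rogawski1990] J. D. Rogawski, *Automorphic Representations of Unitary Groups in Three Variables*, Ann. of Math. Stud. 123 (1990), §3.1 p. 19, §3.6 p. 31 (the two
  Cartan subgroups of `U(1,1)`), §4.3 p. 42 (`G`-regular elements of `H`), §8.2 p. 122 (Cayley frame).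
* [Knapp1986] A. W. Knapp, *Representation Theory of Semisimple Groups* (1986), Ch. V §3 (every regular element lies in a Cartan subgroup; finitely many classes of Cartans).
-/

set_option autoImplicit false

noncomputable section

open NumberField NumberField.InfinitePlace NumberField.mixedEmbedding Matrix Complex
open scoped MatrixGroups Matrix ComplexConjugate Real Classical

namespace Literature.NumberTheory.Automorphic.UnitaryGroup

open Literature.NumberTheory.Rogawski1990

/-! ## §1 Place normal forms in `U(Φ₂)_w` -/

section Place

/-- `P · diag(l₁, l₂) · P⁻¹ = torusMatrix l₁ l₂` for the Cayley frame `P = (1 1; 1 −1)` (★ `coe_inv_cayleyTwo`: `P⁻¹ = ½P`). [cite: Rogawski1990, §8.2 p. 122] -/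
theorem coe_cayleyTwo_mul_diagonal_mul_inv (l₁ l₂ : ℂ) :
    ((Matrix.GeneralLinearGroup.mkOfDetNeZero !![(1 : ℂ), 1; 1, -1] det_cayleyTwo_ne_zero : GL (Fin 2) ℂ) : Matrix (Fin 2) (Fin 2) ℂ) * Matrix.diagonal ![l₁, l₂] *
        (((Matrix.GeneralLinearGroup.mkOfDetNeZero !![(1 : ℂ), 1; 1, -1] det_cayleyTwo_ne_zero)⁻¹ : GL (Fin 2) ℂ) : Matrix (Fin 2) (Fin 2) ℂ) =
      torusMatrix l₁ l₂ := by
  rw [coe_inv_cayleyTwo, Matrix.GeneralLinearGroup.val_mkOfDetNeZero, torusMatrix_eq]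
  have hd : Matrix.diagonal ![l₁, l₂] = !![l₁, 0; 0, l₂] := by
    ext i j; fin_cases i <;> fin_cases j <;> simp
  rw [hd]
  ext i j
  fin_cases i <;> fin_cases j <;> simp [Matrix.mul_apply, Fin.sum_univ_two] <;> ring

variable (L : Type) [Field L] (w : {w : InfinitePlace L // IsComplex w})

/-- **Split normal form**: a DIAGONAL element `diag(l₁, l₂)` of `U(Φ₂)_w` with `l₁ ≠ l₂` is `diag(e^{x+iθ}, e^{−x+iθ})` with `x ≠ 0` (`l̄₁ l₂ = 1` by ★
`diag_mem_unitary_antidiag_iff`; `x = log ‖l₁‖`, `θ = arg l₁`; `x = 0` would force `l₁ = l₂`). [cite: Rogawski1990, §3.6 p. 31] -/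
theorem exists_eq_hypBlockGL_of_coe_eq_diag (δ : ↥(archLocal L 2 (Matrix.of fun i j : Fin 2 => if i.val + j.val + 1 = 2 then (1 : L) else 0) w)) {l₁ l₂ : ℂ}
    (hδ : ((δ : GL (Fin 2) ℂ) : Matrix (Fin 2) (Fin 2) ℂ) = !![l₁, 0; 0, l₂]) (hne : l₁ ≠ l₂) :
    ∃ x θ : ℝ, x ≠ 0 ∧ (δ : GL (Fin 2) ℂ) = hypBlockGL x θ := by
  have hU := (mem_archLocal_iff L 2 _ w (δ : GL (Fin 2) ℂ)).1 δ.2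
  rw [Literature.NumberTheory.Rogawski1990.antidiagOne_map, hδ] at hU
  have hpq : conj l₁ * l₂ = 1 := (diag_mem_unitary_antidiag_iff l₁ l₂).1 hU
  have hp : l₁ ≠ 0 := by
    intro h0; rw [h0, map_zero, zero_mul] at hpq; exact zero_ne_one hpq
  set x : ℝ := Real.log ‖l₁‖ with hx
  set θ : ℝ := Complex.arg l₁ with hθ
  have e0 : Complex.exp ((x : ℂ) + (θ : ℂ) * I) = l₁ := by
    rw [Complex.exp_add, ← Complex.ofReal_exp, Real.exp_log (norm_pos_iff.2 hp)]
    exact Complex.norm_mul_exp_arg_mul_I l₁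
  have e1 : Complex.exp (-(x : ℂ) + (θ : ℂ) * I) = l₂ := by
    have hstar : conj l₁ = Complex.exp ((x : ℂ) - (θ : ℂ) * I) := by
      rw [← e0, ← Complex.exp_conj, map_add, map_mul, Complex.conj_ofReal, Complex.conj_ofReal, Complex.conj_I]
      ring_nf
    have h2 : l₂ = (conj l₁)⁻¹ := eq_inv_of_mul_eq_one_right hpq
    rw [h2, hstar, ← Complex.exp_neg]
    congr 1
    ring
  refine ⟨x, θ, ?_, Matrix.GeneralLinearGroup.ext fun i j => ?_⟩
  · -- `x = 0` would give `l₁ = l₂`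
    intro hx0
    apply hne
    rw [← e0, ← e1, hx0]
    simp
  · rw [hδ, coe_hypBlockGL]
    fin_cases i <;> fin_cases j
    · simpa using e0.symm
    · simp
    · simp
    · simpa using e1.symm

/-- **Compact normal form**: an element of `U(Φ₂)_w` whose matrix is `torusMatrix l₁ l₂ = P·diag(l₁, l₂)·P⁻¹`, `l₁ ≠ l₂`, is the Cayley block of two DISTINCT unit circle
points (`P⁻¹ u P ∈ U(diag(2, −2))` forces `|l_i| = 1`). [cite: Rogawski1990, §8.2 p. 122; §3.6 p. 31] -/
theorem exists_eq_cayley_conj_circleDiagonal_of_coe_eq_torusMatrix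
    (u : ↥(archLocal L 2 (Matrix.of fun i j : Fin 2 => if i.val + j.val + 1 = 2 then (1 : L) else 0) w)) {l₁ l₂ : ℂ}
    (hu : ((u : GL (Fin 2) ℂ) : Matrix (Fin 2) (Fin 2) ℂ) = torusMatrix l₁ l₂) (hne : l₁ ≠ l₂) :
    ∃ θ₀ θ₂ : ℝ, Circle.exp θ₀ ≠ Circle.exp θ₂ ∧
      (u : GL (Fin 2) ℂ) = Matrix.GeneralLinearGroup.mkOfDetNeZero !![(1 : ℂ), 1; 1, -1] det_cayleyTwo_ne_zero *
        circleDiagonal 2 ![Circle.exp θ₀, Circle.exp θ₂] * (Matrix.GeneralLinearGroup.mkOfDetNeZero !![(1 : ℂ), 1; 1, -1] det_cayleyTwo_ne_zero)⁻¹ := by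
  generalize hP : Matrix.GeneralLinearGroup.mkOfDetNeZero !![(1 : ℂ), 1; 1, -1] det_cayleyTwo_ne_zero = P
  -- `v = P⁻¹ u P` is the diagonal `diag(l₁, l₂)` and lies in `U(diag(2, −2))`
  have hv : ((P⁻¹ * (u : GL (Fin 2) ℂ) * P : GL (Fin 2) ℂ) : Matrix (Fin 2) (Fin 2) ℂ) = Matrix.diagonal ![l₁, l₂] := by
    have hPu : IsUnit ((P : GL (Fin 2) ℂ) : Matrix (Fin 2) (Fin 2) ℂ).det := (Matrix.isUnit_iff_isUnit_det _).1 (Units.isUnit P)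
    rw [Units.val_mul, Units.val_mul, hu, ← coe_cayleyTwo_mul_diagonal_mul_inv, hP, Matrix.coe_units_inv]
    simp only [Matrix.mul_assoc]
    rw [Matrix.nonsing_inv_mul _ hPu, Matrix.mul_one, Matrix.nonsing_inv_mul_cancel_left _ _ hPu]
  have hvd : ((P⁻¹ * (u : GL (Fin 2) ℂ) * P : GL (Fin 2) ℂ) : Matrix (Fin 2) (Fin 2) ℂ) =
      Matrix.diagonal fun i => ((P⁻¹ * (u : GL (Fin 2) ℂ) * P : GL (Fin 2) ℂ) : Matrix (Fin 2) (Fin 2) ℂ) i i := by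
    conv_lhs => rw [hv]
    congr 1
    funext i
    rw [hv, Matrix.diagonal_apply_eq]
  have hmem : P⁻¹ * (u : GL (Fin 2) ℂ) * P ∈ unitaryGroupOfForm (starRingEnd ℂ) (Matrix.diagonal ![(2 : ℂ), -2]) := by
    have h1 : P * (P⁻¹ * (u : GL (Fin 2) ℂ) * P) * P⁻¹ = (u : GL (Fin 2) ℂ) := by
      simp only [mul_assoc, mul_inv_cancel, mul_one, mul_inv_cancel_left]
    have h2 : P * (P⁻¹ * (u : GL (Fin 2) ℂ) * P) * P⁻¹ ∈ unitaryGroupOfForm (starRingEnd ℂ)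
        ((Matrix.of fun i j : Fin 2 => if i.val + j.val + 1 = 2 then (1 : L) else 0).map w.1.embedding) := by
      rw [h1]; exact u.2
    have h3 := (conj_mem_unitaryGroupOfForm_iff (starRingEnd ℂ) P _ _).1 h2
    rwa [← hP, formCongr_cayleyTwo, hP] at h3
  obtain ⟨z, hz⟩ := exists_eq_circleDiagonal_of_mem_unitaryGroupOfForm_diagonal (e := ![(2 : ℂ), -2]) (fun i => by fin_cases i <;> simp) hmem hvd
  -- the circle points are `l₁, l₂`
  have hzval : ∀ i, (z i : ℂ) = ![l₁, l₂] i := by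
    intro i
    have h := congrArg (fun g : GL (Fin 2) ℂ => (g : Matrix (Fin 2) (Fin 2) ℂ) i i) hz
    simp only [coe_circleDiagonal, Matrix.diagonal_apply_eq] at h
    rw [hv, Matrix.diagonal_apply_eq] at h
    exact h.symm
  refine ⟨Complex.arg (z 0 : ℂ), Complex.arg (z 1 : ℂ), ?_, ?_⟩
  · rw [Circle.exp_arg, Circle.exp_arg]
    intro h
    apply hne
    have h' := congrArg (fun t : Circle => (t : ℂ)) h
    simpa [hzval] using h'
  · have hzz : (![Circle.exp (Complex.arg (z 0 : ℂ)), Circle.exp (Complex.arg (z 1 : ℂ))] : Fin 2 → Circle) = z := by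
      funext i; fin_cases i <;> simp [Circle.exp_arg]
    rw [hzz, ← hz]
    simp only [mul_assoc, mul_inv_cancel, mul_one, mul_inv_cancel_left]

/-- **The place dichotomy in chart form**: a `U(Φ₂)_w`-element with separable characteristic polynomial is `U(Φ₂)_w`-conjugate EITHER to a Cayley block of two distinct
unit circle points OR to `diag(e^{x+iθ}, e^{−x+iθ})` with `x ≠ 0` (★ `exists_conj_torusMatrix_or_diagonal_archLocal` + the two normal forms above).
[cite: Rogawski1990, §3.6 p. 31; §3.1 p. 19] [cite: Knapp1986, Ch. V §3] -/
theorem exists_conj_endoBlock_or (γ : ↥(archLocal L 2 (Matrix.of fun i j : Fin 2 => if i.val + j.val + 1 = 2 then (1 : L) else 0) w))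
    (hsep : ((γ : GL (Fin 2) ℂ) : Matrix (Fin 2) (Fin 2) ℂ).charpoly.Separable) :
    (∃ (k : ↥(archLocal L 2 (Matrix.of fun i j : Fin 2 => if i.val + j.val + 1 = 2 then (1 : L) else 0) w)) (θ₀ θ₂ : ℝ), Circle.exp θ₀ ≠ Circle.exp θ₂ ∧
        (γ : GL (Fin 2) ℂ) = (k : GL (Fin 2) ℂ) * (Matrix.GeneralLinearGroup.mkOfDetNeZero !![(1 : ℂ), 1; 1, -1] det_cayleyTwo_ne_zero *
          circleDiagonal 2 ![Circle.exp θ₀, Circle.exp θ₂] * (Matrix.GeneralLinearGroup.mkOfDetNeZero !![(1 : ℂ), 1; 1, -1] det_cayleyTwo_ne_zero)⁻¹) * (k : GL (Fin 2) ℂ)⁻¹) ∨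
      (∃ (k : ↥(archLocal L 2 (Matrix.of fun i j : Fin 2 => if i.val + j.val + 1 = 2 then (1 : L) else 0) w)) (x θ : ℝ), x ≠ 0 ∧
        (γ : GL (Fin 2) ℂ) = (k : GL (Fin 2) ℂ) * hypBlockGL x θ * (k : GL (Fin 2) ℂ)⁻¹) := by
  rcases exists_conj_torusMatrix_or_diagonal_archLocal L w γ hsep with ⟨g₀, l₁, l₂, hne, hγ⟩ | ⟨h, δ, l₁, l₂, hne, hδ, hconj⟩
  · left
    -- `u = g₀⁻¹ γ g₀` has matrix `torusMatrix l₁ l₂`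
    have hg₀u : IsUnit ((g₀ : GL (Fin 2) ℂ) : Matrix (Fin 2) (Fin 2) ℂ).det := (Matrix.isUnit_iff_isUnit_det _).1 (Units.isUnit _)
    have hu : (((g₀⁻¹ * γ * g₀ : ↥(archLocal L 2 (Matrix.of fun i j : Fin 2 => if i.val + j.val + 1 = 2 then (1 : L) else 0) w)) : GL (Fin 2) ℂ) :
        Matrix (Fin 2) (Fin 2) ℂ) = torusMatrix l₁ l₂ := by
      rw [Subgroup.coe_mul, Subgroup.coe_mul, Subgroup.coe_inv, Units.val_mul, Units.val_mul, Matrix.coe_units_inv, hγ]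
      simp only [Matrix.mul_assoc]
      rw [Matrix.nonsing_inv_mul _ hg₀u, Matrix.mul_one, Matrix.nonsing_inv_mul_cancel_left _ _ hg₀u]
    obtain ⟨θ₀, θ₂, hne', hu'⟩ := exists_eq_cayley_conj_circleDiagonal_of_coe_eq_torusMatrix L w (g₀⁻¹ * γ * g₀) hu hne
    refine ⟨g₀, θ₀, θ₂, hne', ?_⟩
    rw [← hu', Subgroup.coe_mul, Subgroup.coe_mul, Subgroup.coe_inv]
    simp only [mul_assoc, mul_inv_cancel, mul_one, mul_inv_cancel_left]
  · right
    obtain ⟨x, θ, hx, hδ'⟩ := exists_eq_hypBlockGL_of_coe_eq_diag L w δ hδ hne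
    refine ⟨h, x, θ, hx, ?_⟩
    rw [hconj, Subgroup.coe_mul, Subgroup.coe_mul, Subgroup.coe_inv, hδ']

end Place

/-! ## §2 Exhaustion of the `G`-regular set of `H_∞` by the charts -/

section Global

variable (L : Type) [Field L] [NumberField L] [IsCMField L]

/-- **`G`-regularity of the chart reads `RegG`** ((COORD) dock of ★ `isArchGRegular_endoTorus_iff`). [cite: Rogawski1990, §4.3 p. 42] [cite: Shelstad1979, §4 p. 22] -/
theorem isArchGRegular_endoTorus_iff_mem_regG (S : Finset {w : InfinitePlace L // IsComplex w}) (c : {w : InfinitePlace L // IsComplex w} → Fin 3 → ℝ) :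
    IsArchGRegular L (endoTorus L S c) ↔ c ∈ ArchCartan.RegG S := by
  rw [isArchGRegular_endoTorus_iff, ArchCartan.mem_regG_iff]
  have hcirc : ∀ w : {w : InfinitePlace L // IsComplex w},
      Function.Injective (![(Circle.exp (c w 0) : ℂ), (Circle.exp (c w 1) : ℂ), (Circle.exp (c w 2) : ℂ)] : Fin 3 → ℂ) ↔
        Function.Injective fun i : Fin 3 => Circle.exp (c w i) := by
    intro w
    have hv : (![(Circle.exp (c w 0) : ℂ), (Circle.exp (c w 1) : ℂ), (Circle.exp (c w 2) : ℂ)] : Fin 3 → ℂ) = fun i => ((Circle.exp (c w i) : Circle) : ℂ) := by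
      funext i; fin_cases i <;> rfl
    rw [hv]
    constructor
    · intro h i j hij
      exact h (congrArg (fun t : Circle => (t : ℂ)) hij)
    · intro h i j hij
      exact h (Circle.ext hij)
  constructor
  · rintro ⟨h1, h2⟩; exact ⟨fun w hw => (hcirc w).1 (h1 w hw), h2⟩
  · rintro ⟨h1, h2⟩; exact ⟨fun w hw => (hcirc w).2 (h1 w hw), h2⟩

/-- **(EXH-H) EVERY `G`-REGULAR ELEMENT OF `H_∞` IS `H_∞`-CONJUGATE TO A REGULAR CHART POINT**: `γ = h · endoTorus S c · h⁻¹` with `c ∈ RegG S`, where `S` is the set of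
places at which the `2`-block of `γ` is hyperbolic (★ DICH place by place, log∕arg coordinates, `U(Φ₁)` angle; `G`-regularity transported by ★ `isArchGRegular_conj`).
[cite: Rogawski1990, §3.1 p. 19; §3.6 p. 31; §4.3 p. 42] [cite: Knapp1986, Ch. V §3] -/
theorem exists_conj_endoTorus_of_isArchGRegular (γ : (↥(arch (↥(maximalRealSubfield L)) L (IsCMField.complexConj L) 2 (Matrix.of fun i j : Fin 2 => if i.val + j.val + 1 = 2 then (1 : L) else 0)) × ↥(arch (↥(maximalRealSubfield L)) L (IsCMField.complexConj L) 1 (Matrix.of fun i j : Fin 1 => if i.val + j.val + 1 = 1 then (1 : L) else 0)))) (hreg : IsArchGRegular L γ) :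
    ∃ (S : Finset {w : InfinitePlace L // IsComplex w}) (c : {w : InfinitePlace L // IsComplex w} → Fin 3 → ℝ) (h : (↥(arch (↥(maximalRealSubfield L)) L (IsCMField.complexConj L) 2 (Matrix.of fun i j : Fin 2 => if i.val + j.val + 1 = 2 then (1 : L) else 0)) × ↥(arch (↥(maximalRealSubfield L)) L (IsCMField.complexConj L) 1 (Matrix.of fun i j : Fin 1 => if i.val + j.val + 1 = 1 then (1 : L) else 0)))),
      c ∈ ArchCartan.RegG S ∧ γ = h * endoTorus L S c * h⁻¹ := by
  -- the hyperbolic places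
  set S : Finset {w : InfinitePlace L // IsComplex w} := Finset.univ.filter fun w =>
    ∃ (k : ↥(archLocal L 2 (Matrix.of fun i j : Fin 2 => if i.val + j.val + 1 = 2 then (1 : L) else 0) w)) (x θ : ℝ), x ≠ 0 ∧
      ((archPiEquivCM 2 L (Matrix.of fun i j : Fin 2 => if i.val + j.val + 1 = 2 then (1 : L) else 0) γ.1 w : ↥(archLocal L 2 (Matrix.of fun i j : Fin 2 => if i.val + j.val + 1 = 2 then (1 : L) else 0) w)) : GL (Fin 2) ℂ) = (k : GL (Fin 2) ℂ) * hypBlockGL x θ * (k : GL (Fin 2) ℂ)⁻¹ with hS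
  -- per-place data: a conjugator `k_w ∈ U(Φ₂)_w` and coordinates `c w` with `γ₂,w = k_w · endoBlock S c w · k_w⁻¹`, `γ₁,w = endoCircle c w`
  have key : ∀ w : {w : InfinitePlace L // IsComplex w}, ∃ (k : ↥(archLocal L 2 (Matrix.of fun i j : Fin 2 => if i.val + j.val + 1 = 2 then (1 : L) else 0) w)) (cw : Fin 3 → ℝ),
      ((archPiEquivCM 2 L (Matrix.of fun i j : Fin 2 => if i.val + j.val + 1 = 2 then (1 : L) else 0) γ.1 w : ↥(archLocal L 2 (Matrix.of fun i j : Fin 2 => if i.val + j.val + 1 = 2 then (1 : L) else 0) w)) : GL (Fin 2) ℂ) =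
          (k : GL (Fin 2) ℂ) * (endoBlock L S (fun _ => cw) w : GL (Fin 2) ℂ) * (k : GL (Fin 2) ℂ)⁻¹ ∧
        ((archPiEquivCM 1 L (Matrix.of fun i j : Fin 1 => if i.val + j.val + 1 = 1 then (1 : L) else 0) γ.2 w : ↥(archLocal L 1 (Matrix.of fun i j : Fin 1 => if i.val + j.val + 1 = 1 then (1 : L) else 0) w)) : GL (Fin 1) ℂ) = (endoCircle L (fun _ => cw) w : GL (Fin 1) ℂ) := by
    intro w
    obtain ⟨φ, hφ⟩ := exists_eq_circleDiagonal_one L w (archPiEquivCM 1 L (Matrix.of fun i j : Fin 1 => if i.val + j.val + 1 = 1 then (1 : L) else 0) γ.2 w)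
    have hsep := charpoly_archPiEquivCM_separable_of_isArchGRegular L γ hreg w
    by_cases hw : w ∈ S
    · have hw' := (Finset.mem_filter.1 hw).2
      obtain ⟨k, x, θ, hx, hk⟩ := hw'
      refine ⟨k, ![x, φ, θ], ?_, ?_⟩
      · rw [hk, coe_endoBlock_eq_hypBlockGL_of_mem L S _ hw]; rfl
      · rw [hφ, coe_endoCircle_eq]; rfl
    · have hw' : ¬ ∃ (k : ↥(archLocal L 2 (Matrix.of fun i j : Fin 2 => if i.val + j.val + 1 = 2 then (1 : L) else 0) w)) (x θ : ℝ), x ≠ 0 ∧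
          ((archPiEquivCM 2 L (Matrix.of fun i j : Fin 2 => if i.val + j.val + 1 = 2 then (1 : L) else 0) γ.1 w : ↥(archLocal L 2 (Matrix.of fun i j : Fin 2 => if i.val + j.val + 1 = 2 then (1 : L) else 0) w)) : GL (Fin 2) ℂ) = (k : GL (Fin 2) ℂ) * hypBlockGL x θ * (k : GL (Fin 2) ℂ)⁻¹ :=
        fun h => hw (Finset.mem_filter.2 ⟨Finset.mem_univ w, h⟩)
      rcases exists_conj_endoBlock_or L w _ hsep with ⟨k, θ₀, θ₂, hne, hk⟩ | hsplit
      · refine ⟨k, ![θ₀, φ, θ₂], ?_, ?_⟩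
        · rw [hk, coe_endoBlock_eq_cayley_of_not_mem L S _ hw]; rfl
        · rw [hφ, coe_endoCircle_eq]; rfl
      · exact absurd hsplit hw'
  choose k c hkc using key
  have hconj : γ = (((archPiEquivCM 2 L (Matrix.of fun i j : Fin 2 => if i.val + j.val + 1 = 2 then (1 : L) else 0)).symm k, 1) : (↥(arch (↥(maximalRealSubfield L)) L (IsCMField.complexConj L) 2 (Matrix.of fun i j : Fin 2 => if i.val + j.val + 1 = 2 then (1 : L) else 0)) × ↥(arch (↥(maximalRealSubfield L)) L (IsCMField.complexConj L) 1 (Matrix.of fun i j : Fin 1 => if i.val + j.val + 1 = 1 then (1 : L) else 0)))) * endoTorus L S c *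
      (((archPiEquivCM 2 L (Matrix.of fun i j : Fin 2 => if i.val + j.val + 1 = 2 then (1 : L) else 0)).symm k, 1) : (↥(arch (↥(maximalRealSubfield L)) L (IsCMField.complexConj L) 2 (Matrix.of fun i j : Fin 2 => if i.val + j.val + 1 = 2 then (1 : L) else 0)) × ↥(arch (↥(maximalRealSubfield L)) L (IsCMField.complexConj L) 1 (Matrix.of fun i j : Fin 1 => if i.val + j.val + 1 = 1 then (1 : L) else 0))))⁻¹ := by
    refine Prod.ext ?_ ?_
    · apply (archPiEquivCM 2 L (Matrix.of fun i j : Fin 2 => if i.val + j.val + 1 = 2 then (1 : L) else 0)).injective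
      rw [Prod.fst_mul, Prod.fst_mul, Prod.fst_inv, map_mul, map_mul, map_inv, ContinuousMulEquiv.apply_symm_apply,
        show (endoTorus L S c).1 = (archPiEquivCM 2 L (Matrix.of fun i j : Fin 2 => if i.val + j.val + 1 = 2 then (1 : L) else 0)).symm (endoBlock L S c) from rfl, ContinuousMulEquiv.apply_symm_apply]
      funext w
      rw [Pi.mul_apply, Pi.mul_apply, Pi.inv_apply]
      apply Subtype.ext
      rw [Subgroup.coe_mul, Subgroup.coe_mul, Subgroup.coe_inv, (hkc w).1]
      by_cases hw : w ∈ S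
      · rw [coe_endoBlock_eq_hypBlockGL_of_mem L S _ hw, coe_endoBlock_eq_hypBlockGL_of_mem L S _ hw]
      · rw [coe_endoBlock_eq_cayley_of_not_mem L S _ hw, coe_endoBlock_eq_cayley_of_not_mem L S _ hw]
    · apply (archPiEquivCM 1 L (Matrix.of fun i j : Fin 1 => if i.val + j.val + 1 = 1 then (1 : L) else 0)).injective
      rw [Prod.snd_mul, Prod.snd_mul, Prod.snd_inv, inv_one, one_mul, mul_one,
        show (endoTorus L S c).2 = (archPiEquivCM 1 L (Matrix.of fun i j : Fin 1 => if i.val + j.val + 1 = 1 then (1 : L) else 0)).symm (endoCircle L c) from rfl, ContinuousMulEquiv.apply_symm_apply]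
      funext w
      apply Subtype.ext
      rw [(hkc w).2, coe_endoCircle_eq, coe_endoCircle_eq]
  refine ⟨S, c, (((archPiEquivCM 2 L (Matrix.of fun i j : Fin 2 => if i.val + j.val + 1 = 2 then (1 : L) else 0)).symm k, 1) : (↥(arch (↥(maximalRealSubfield L)) L (IsCMField.complexConj L) 2 (Matrix.of fun i j : Fin 2 => if i.val + j.val + 1 = 2 then (1 : L) else 0)) × ↥(arch (↥(maximalRealSubfield L)) L (IsCMField.complexConj L) 1 (Matrix.of fun i j : Fin 1 => if i.val + j.val + 1 = 1 then (1 : L) else 0)))), ?_, hconj⟩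
  -- regularity: `G`-regularity is a class invariant and reads `RegG` on the chart
  rw [← isArchGRegular_endoTorus_iff_mem_regG]
  have hrew : endoTorus L S c = (((archPiEquivCM 2 L (Matrix.of fun i j : Fin 2 => if i.val + j.val + 1 = 2 then (1 : L) else 0)).symm k, 1) : (↥(arch (↥(maximalRealSubfield L)) L (IsCMField.complexConj L) 2 (Matrix.of fun i j : Fin 2 => if i.val + j.val + 1 = 2 then (1 : L) else 0)) × ↥(arch (↥(maximalRealSubfield L)) L (IsCMField.complexConj L) 1 (Matrix.of fun i j : Fin 1 => if i.val + j.val + 1 = 1 then (1 : L) else 0))))⁻¹ * γ *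
      ((((archPiEquivCM 2 L (Matrix.of fun i j : Fin 2 => if i.val + j.val + 1 = 2 then (1 : L) else 0)).symm k, 1) : (↥(arch (↥(maximalRealSubfield L)) L (IsCMField.complexConj L) 2 (Matrix.of fun i j : Fin 2 => if i.val + j.val + 1 = 2 then (1 : L) else 0)) × ↥(arch (↥(maximalRealSubfield L)) L (IsCMField.complexConj L) 1 (Matrix.of fun i j : Fin 1 => if i.val + j.val + 1 = 1 then (1 : L) else 0))))⁻¹)⁻¹ := by
    rw [inv_inv]
    conv_rhs => rw [hconj]
    simp only [mul_assoc, inv_mul_cancel_left, inv_mul_cancel, mul_one]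
  rw [hrew]
  exact isArchGRegular_conj L γ _ hreg

end Global

end Literature.NumberTheory.Automorphic.UnitaryGroup

end
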